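import Mathlib
import Literature.NumberTheory.LFunctions.LittlewoodCriterion
import Literature.NumberTheory.Sieve.MoebiusShiftedPrimesLiouville

/-!
# Calibration of the one-point stub K2 against the quasi-Riemann hypothesis

Stub `stub_quasiRH_of_progressionMean` of line `SketchIdeator3` of crux stmt-Parity-13317
(`Summit.Parity.GeneralizedHardyLittlewood.Theses.LiouvilleMAD.CosetDecorrelation`, card
`farey-level-mean-coupling`, K2 paragraph).  The one-point stub K2 of the skeleton asserts a power
saving `|Σ_{m ∈ (M,2M]} λ(mn+c)| ≤ C·M^{3/4−κ/2}` for `λ` along every progression `c mod n`,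
`1 ≤ n ≤ 2M`.  We GRADE it: already its instance `c = 1, n = 1` forces `ζ(s) ≠ 0` on
`θ < Re s < 1` for some `θ < 3/4` (`Literature.NumberTheory.LFunctions.QuasiRiemannHypothesis θ`).

Route (each step a general lemma):

1. `stub_quasiRH_of_progressionMean` (S1): specialise K2 to `c = 1`, `n = 1`
   (`Int.toNat (m·1+1) = m+1`), giving `|Σ_{m∈(M,2M]} λ(m+1)| ≤ C·M^θ` for `M ≥ 1` with
   `θ = 3/4 − min κ (1/4) / 2 ∈ [5/8, 3/4)`.
2. `quasiRH_descent` (S2, binary descent): for any `|a| ≤ 1` with dyadic block bounds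
   `|Σ_{(M,2M]} a| ≤ C M^θ` (`0 < θ ≤ 1`), `|Σ_{(0,N]} a| ≤ D N^θ` with `D = (C+1)/(2^θ−1)`
   (split `(0,N] = (0,M] ∪ (M,2M] ∪ (2M,N]`, `M = ⌊N/2⌋`, strong induction).
3. `quasiRH_sum_liouville_succ`, `quasiRH_liouvilleSum_bound` (S3): `L(K+1) = 1 + Σ_{(0,K]} λ(m+1)`,
   hence `|L(K)| ≤ (D+1) K^θ` for the summatory Liouville function `L(K) = Σ_{k ≤ K} λ(k)`.
4. `quasiRH_sum_moebius_eq`, `quasiRH_mertens_natCast_bound` (S4): `μ = λ ∗ h`, `h(d²) = μ(d)`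
   (tree: `Literature.NumberTheory.Sieve.Lichtman2020.moebius_eq_sum_sq_dvd`) gives
   `M(X) = Σ_{d ≤ X} μ(d) L(⌊X/d²⌋)`, so `|M(X)| ≤ (D+1) (Σ_d d^{-2θ}) X^θ` (`2θ > 1`).
5. `quasiRH_mertens_isBigO` (S5): `M(x) = M(⌊x⌋) = O(x^θ)` along `Filter.atTop`.
6. The Mertens dictionary (tree, PROVED:
   `Literature.NumberTheory.LFunctions.quasiRiemannHypothesis_of_mertens_isBigO_holds`,
   Landau 1899 / Littlewood 1912 / Titchmarsh 1986 §14.25 for general exponent) turns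
   `M(x) = O(x^θ)`, `0 < θ < 1`, into `QuasiRiemannHypothesis θ`.

Sources: line SketchIdeator3 of crux stmt-Parity-13317 (card farey-level-mean-coupling, K2
paragraph); Landau 1899 / Titchmarsh 1986 §14.25 via the tree's Mertens dictionary; Lichtman 2020
§2 for `μ = λ ∗ h`.
-/

namespace Summit.Parity.GeneralizedHardyLittlewood.Theorems.CosetDecorrelation.FareyLevelMeanCoupling

open Finset

/-- **Binary descent (S2).**  If `|a m| ≤ 1` and the dyadic block sums satisfy
`|Σ_{m ∈ (M,2M]} a m| ≤ C·M^θ` for all `M ≥ 1` (`0 < θ ≤ 1`, `C ≥ 0`), then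
`|Σ_{m ∈ (0,N]} a m| ≤ D·N^θ` for all `N`, with `D = (C+1)/(2^θ−1)`.  Proof: strong induction,
`(0,N] = (0,M] ∪ (M,2M] ∪ (2M,N]` with `M = ⌊N/2⌋`, the last block having at most one term, and
`D·M^θ + C·M^θ + 1 ≤ (D+C+1)·M^θ = D·2^θ·M^θ = D·(2M)^θ ≤ D·N^θ`. [folklore] -/
theorem quasiRH_descent (a : ℕ → ℝ) (ha : ∀ m, |a m| ≤ 1) {θ C : ℝ} (hθ : 0 < θ) (hθ1 : θ ≤ 1)
    (hC : 0 ≤ C)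
    (hb : ∀ M : ℕ, 1 ≤ M → |∑ m ∈ Finset.Ioc M (2 * M), a m| ≤ C * (M : ℝ) ^ θ) :
    ∃ D : ℝ, 0 ≤ D ∧ ∀ N : ℕ, |∑ m ∈ Finset.Ioc 0 N, a m| ≤ D * (N : ℝ) ^ θ := by
  have h2θ : (1 : ℝ) < (2 : ℝ) ^ θ := Real.one_lt_rpow (by norm_num) hθ
  have h2θ' : (2 : ℝ) ^ θ ≤ 2 := by
    simpa using Real.rpow_le_rpow_of_exponent_le (by norm_num : (1 : ℝ) ≤ 2) hθ1
  set t : ℝ := (2 : ℝ) ^ θ with ht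
  have ht0 : 0 < t - 1 := by linarith
  set D : ℝ := (C + 1) / (t - 1) with hD
  have hD0 : 0 ≤ D := by positivity
  have hD1 : 1 ≤ D := by
    rw [hD, le_div_iff₀ ht0]
    linarith
  have hDt : D * t = D + C + 1 := by
    have : D * (t - 1) = C + 1 := by rw [hD]; field_simp
    linarith
  refine ⟨D, hD0, fun N => ?_⟩
  induction N using Nat.strong_induction_on with
  | _ N ih =>
  rcases Nat.lt_or_ge N 2 with hN | hN
  · interval_cases N
    · simp only [Finset.Ioc_self, Finset.sum_empty, abs_zero]
      positivity
    · rw [Finset.sum_Ioc_succ_top (le_refl 0)]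
      simp only [Finset.Ioc_self, Finset.sum_empty, zero_add, Nat.cast_one, Real.one_rpow, mul_one]
      exact (ha 1).trans hD1
  · set M : ℕ := N / 2 with hM
    have hM1 : 1 ≤ M := by omega
    have hMN : M < N := by omega
    have h2M : 2 * M ≤ N := by omega
    have hr : N - 2 * M ≤ 1 := by omega
    have hsplit : ∑ m ∈ Ioc 0 N, a m
        = ∑ m ∈ Ioc 0 M, a m + ∑ m ∈ Ioc M (2 * M), a m + ∑ m ∈ Ioc (2 * M) N, a m := by
      rw [Finset.sum_Ioc_consecutive _ (Nat.zero_le M) (by omega : M ≤ 2 * M),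
        Finset.sum_Ioc_consecutive _ (Nat.zero_le _) h2M]
    have htail : |∑ m ∈ Ioc (2 * M) N, a m| ≤ 1 := by
      calc |∑ m ∈ Ioc (2 * M) N, a m| ≤ ∑ m ∈ Ioc (2 * M) N, |a m| :=
            Finset.abs_sum_le_sum_abs _ _
        _ ≤ ∑ _m ∈ Ioc (2 * M) N, (1 : ℝ) := Finset.sum_le_sum fun m _ => ha m
        _ = ((N - 2 * M : ℕ) : ℝ) := by simp
        _ ≤ 1 := by exact_mod_cast hr
    have hMθ : (1 : ℝ) ≤ (M : ℝ) ^ θ := Real.one_le_rpow (by exact_mod_cast hM1) hθ.le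
    have h2Mθ : ((2 * M : ℕ) : ℝ) ^ θ = t * (M : ℝ) ^ θ := by
      rw [Nat.cast_mul, Nat.cast_two, Real.mul_rpow (by norm_num) (Nat.cast_nonneg _)]
    have hmono : ((2 * M : ℕ) : ℝ) ^ θ ≤ (N : ℝ) ^ θ :=
      Real.rpow_le_rpow (Nat.cast_nonneg _) (by exact_mod_cast h2M) hθ.le
    calc |∑ m ∈ Ioc 0 N, a m|
        ≤ |∑ m ∈ Ioc 0 M, a m| + |∑ m ∈ Ioc M (2 * M), a m| + |∑ m ∈ Ioc (2 * M) N, a m| := by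
          rw [hsplit]
          exact (abs_add_le _ _).trans (by gcongr; exact abs_add_le _ _)
      _ ≤ D * (M : ℝ) ^ θ + C * (M : ℝ) ^ θ + 1 :=
          add_le_add (add_le_add (ih M hMN) (hb M hM1)) htail
      _ ≤ D * (M : ℝ) ^ θ + C * (M : ℝ) ^ θ + (M : ℝ) ^ θ := by linarith
      _ = D * ((2 * M : ℕ) : ℝ) ^ θ := by rw [h2Mθ, ← mul_assoc, hDt]; ring
      _ ≤ D * (N : ℝ) ^ θ := mul_le_mul_of_nonneg_left hmono hD0

/-- **Index shift (S3).**
`Σ_{k ∈ (0,K+1]} λ(k) = λ(1) + Σ_{m ∈ (0,K]} λ(m+1) = 1 + Σ_{m ∈ (0,K]} λ(m+1)`. [folklore] -/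
theorem quasiRH_sum_liouville_succ (K : ℕ) :
    ∑ k ∈ Finset.Ioc 0 (K + 1), (ArithmeticFunction.liouville k : ℝ)
      = 1 + ∑ m ∈ Finset.Ioc 0 K, (ArithmeticFunction.liouville (m + 1) : ℝ) := by
  induction K with
  | zero =>
    rw [Finset.sum_Ioc_succ_top (le_refl 0)]
    simp [ArithmeticFunction.liouville_apply_one]
  | succ K ih =>
    rw [Finset.sum_Ioc_succ_top (Nat.zero_le (K + 1)), ih,
      Finset.sum_Ioc_succ_top (Nat.zero_le K)]
    ring

/-- **Summatory Liouville bound (S3).**  Dyadic block bounds `|Σ_{m∈(M,2M]} λ(m+1)| ≤ C·M^θ`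
(`M ≥ 1`, `0 < θ ≤ 1`, `C ≥ 0`) give `|L(K)| = |Σ_{k ∈ (0,K]} λ(k)| ≤ E·K^θ` for all `K`, with
`E = D + 1`, `D` from `quasiRH_descent` (`L(K) = 1 + Σ_{(0,K-1]} λ(m+1)` and `1 ≤ K^θ`).
[folklore] -/
theorem quasiRH_liouvilleSum_bound {θ C : ℝ} (hθ : 0 < θ) (hθ1 : θ ≤ 1) (hC : 0 ≤ C)
    (hb : ∀ M : ℕ, 1 ≤ M →
      |∑ m ∈ Finset.Ioc M (2 * M), (ArithmeticFunction.liouville (m + 1) : ℝ)|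
        ≤ C * (M : ℝ) ^ θ) :
    ∃ E : ℝ, 0 ≤ E ∧ ∀ K : ℕ,
      |∑ k ∈ Finset.Ioc 0 K, (ArithmeticFunction.liouville k : ℝ)| ≤ E * (K : ℝ) ^ θ := by
  obtain ⟨D, hD0, hD⟩ := quasiRH_descent (fun m => (ArithmeticFunction.liouville (m + 1) : ℝ))
    (fun m => by
      exact_mod_cast Literature.NumberTheory.Sieve.Lichtman2020.abs_liouville_le_one (m + 1))
    hθ hθ1 hC hb
  have hD' : ∀ N : ℕ,
      |∑ m ∈ Finset.Ioc 0 N, (ArithmeticFunction.liouville (m + 1) : ℝ)| ≤ D * (N : ℝ) ^ θ := hD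
  refine ⟨D + 1, by positivity, fun K => ?_⟩
  rcases Nat.eq_zero_or_pos K with rfl | hK
  · simp only [Finset.Ioc_self, Finset.sum_empty, abs_zero]
    positivity
  · obtain ⟨K, rfl⟩ : ∃ K' : ℕ, K = K' + 1 := ⟨K - 1, by omega⟩
    rw [quasiRH_sum_liouville_succ]
    have hK1 : (1 : ℝ) ≤ ((K + 1 : ℕ) : ℝ) := by exact_mod_cast Nat.succ_le_succ (Nat.zero_le K)
    have hKθ : (1 : ℝ) ≤ ((K + 1 : ℕ) : ℝ) ^ θ := Real.one_le_rpow hK1 hθ.le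
    have hmono : (K : ℝ) ^ θ ≤ ((K + 1 : ℕ) : ℝ) ^ θ :=
      Real.rpow_le_rpow (Nat.cast_nonneg _) (by push_cast; linarith) hθ.le
    calc |1 + ∑ m ∈ Ioc 0 K, (ArithmeticFunction.liouville (m + 1) : ℝ)|
        ≤ |(1 : ℝ)| + |∑ m ∈ Ioc 0 K, (ArithmeticFunction.liouville (m + 1) : ℝ)| :=
          abs_add_le _ _
      _ ≤ 1 + D * (K : ℝ) ^ θ := by rw [abs_one]; exact add_le_add le_rfl (hD' K)
      _ ≤ ((K + 1 : ℕ) : ℝ) ^ θ + D * ((K + 1 : ℕ) : ℝ) ^ θ :=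
          add_le_add hKθ (mul_le_mul_of_nonneg_left hmono hD0)
      _ = (D + 1) * ((K + 1 : ℕ) : ℝ) ^ θ := by ring

/-- **`μ = λ ∗ h` summed (S4).**  For every `X`,
`Σ_{n ∈ (0,X]} μ(n) = Σ_{d ∈ [1,X]} μ(d) · Σ_{k ∈ (0, ⌊X/d²⌋]} λ(k)`: insert
`μ(n) = Σ_{d ≤ n, d² ∣ n} μ(d) λ(n/d²)` (tree `moebius_eq_sum_sq_dvd`, Lichtman 2020 §2), swap the
sums, and reindex `n = d²k`. [folklore] -/
theorem quasiRH_sum_moebius_eq (X : ℕ) :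
    ∑ n ∈ Finset.Ioc 0 X, ArithmeticFunction.moebius n
      = ∑ d ∈ Finset.Icc 1 X, ArithmeticFunction.moebius d *
          ∑ k ∈ Finset.Ioc 0 (X / d ^ 2), ArithmeticFunction.liouville k := by
  calc ∑ n ∈ Ioc 0 X, ArithmeticFunction.moebius n
      = ∑ n ∈ Ioc 0 X, ∑ d ∈ (Icc 1 n).filter (fun d => d ^ 2 ∣ n),
          ArithmeticFunction.moebius d * ArithmeticFunction.liouville (n / d ^ 2) :=
        Finset.sum_congr rfl fun n hn =>
          Literature.NumberTheory.Sieve.Lichtman2020.moebius_eq_sum_sq_dvd (Finset.mem_Ioc.1 hn).1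
    _ = ∑ d ∈ Icc 1 X, ∑ n ∈ (Ioc 0 X).filter (fun n => d ^ 2 ∣ n),
          ArithmeticFunction.moebius d * ArithmeticFunction.liouville (n / d ^ 2) := by
        refine Finset.sum_comm' fun n d => ?_
        simp only [Finset.mem_Ioc, Finset.mem_Icc, Finset.mem_filter]
        constructor
        · rintro ⟨⟨hn0, hnX⟩, ⟨hd1, hdn⟩, hdvd⟩
          exact ⟨⟨⟨hn0, hnX⟩, hdvd⟩, hd1, hdn.trans hnX⟩
        · rintro ⟨⟨⟨hn0, hnX⟩, hdvd⟩, hd1, _⟩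
          exact ⟨⟨hn0, hnX⟩, ⟨hd1, (Nat.le_self_pow two_ne_zero d).trans (Nat.le_of_dvd hn0 hdvd)⟩,
            hdvd⟩
    _ = ∑ d ∈ Icc 1 X, ArithmeticFunction.moebius d *
          ∑ k ∈ Ioc 0 (X / d ^ 2), ArithmeticFunction.liouville k := by
        refine Finset.sum_congr rfl fun d hd => ?_
        have hd2 : 0 < d ^ 2 := pow_pos (Finset.mem_Icc.1 hd).1 2
        rw [Finset.mul_sum]
        refine Finset.sum_nbij' (fun n => n / d ^ 2) (fun k => d ^ 2 * k) ?_ ?_ ?_ ?_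
          (fun _ _ => rfl)
        · intro n hn
          simp only [Finset.mem_filter, Finset.mem_Ioc] at hn
          exact Finset.mem_Ioc.2
            ⟨Nat.div_pos (Nat.le_of_dvd hn.1.1 hn.2) hd2, Nat.div_le_div_right hn.1.2⟩
        · intro k hk
          rw [Finset.mem_Ioc] at hk
          simp only [Finset.mem_filter, Finset.mem_Ioc]
          refine ⟨⟨Nat.mul_pos hd2 hk.1, ?_⟩, dvd_mul_right _ _⟩
          rw [mul_comm]
          exact (Nat.le_div_iff_mul_le hd2).1 hk.2
        · intro n hn
          simp only [Finset.mem_filter] at hn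
          exact Nat.mul_div_cancel' hn.2
        · intro k _
          exact Nat.mul_div_cancel_left k hd2

/-- **Mertens bound (S4).**  If `|L(K)| ≤ E·K^θ` for all `K` (`θ > 1/2`, `E ≥ 0`), then
`|M(X)| = |Σ_{n ≤ X} μ(n)| ≤ F·X^θ` for all naturals `X`, with `F = E · Σ'_d d^{-2θ}`: by
`quasiRH_sum_moebius_eq`, `|M(X)| ≤ Σ_{d ≤ X} |L(⌊X/d²⌋)| ≤ E X^θ Σ_{d ≤ X} d^{-2θ}` and the series
converges since `2θ > 1`. [folklore] -/
theorem quasiRH_mertens_natCast_bound {θ E : ℝ} (hθ : 1 / 2 < θ) (hE : 0 ≤ E)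
    (hL : ∀ K : ℕ, |∑ k ∈ Finset.Ioc 0 K, (ArithmeticFunction.liouville k : ℝ)| ≤ E * (K : ℝ) ^ θ) :
    ∃ F : ℝ, 0 ≤ F ∧ ∀ X : ℕ,
      |∑ n ∈ Finset.Ioc 0 X, (ArithmeticFunction.moebius n : ℝ)| ≤ F * (X : ℝ) ^ θ := by
  have hsum : Summable (fun d : ℕ => ((d : ℝ) ^ (2 * θ))⁻¹) :=
    Real.summable_nat_rpow_inv.2 (by linarith)
  set S : ℝ := ∑' d : ℕ, ((d : ℝ) ^ (2 * θ))⁻¹ with hS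
  have hS0 : 0 ≤ S := tsum_nonneg fun d => by positivity
  have hθ0 : 0 ≤ θ := by linarith
  refine ⟨E * S, mul_nonneg hE hS0, fun X => ?_⟩
  have key : ∀ d ∈ Finset.Icc 1 X,
      |(ArithmeticFunction.moebius d : ℝ) *
          ∑ k ∈ Ioc 0 (X / d ^ 2), (ArithmeticFunction.liouville k : ℝ)|
        ≤ E * (X : ℝ) ^ θ * ((d : ℝ) ^ (2 * θ))⁻¹ := by
    intro d hd
    have hd0 : (0 : ℝ) < d := by exact_mod_cast (Finset.mem_Icc.1 hd).1
    have hμ : |(ArithmeticFunction.moebius d : ℝ)| ≤ 1 := by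
      exact_mod_cast ArithmeticFunction.abs_moebius_le_one
    have hdiv : ((X / d ^ 2 : ℕ) : ℝ) ≤ (X : ℝ) / (d : ℝ) ^ 2 := by
      have h := (Nat.cast_div_le (α := ℝ) (m := X) (n := d ^ 2))
      rwa [Nat.cast_pow] at h
    have hq : ((X / d ^ 2 : ℕ) : ℝ) ^ θ ≤ (X : ℝ) ^ θ * ((d : ℝ) ^ (2 * θ))⁻¹ := by
      calc ((X / d ^ 2 : ℕ) : ℝ) ^ θ ≤ ((X : ℝ) / (d : ℝ) ^ 2) ^ θ :=
            Real.rpow_le_rpow (Nat.cast_nonneg _) hdiv hθ0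
        _ = (X : ℝ) ^ θ * ((d : ℝ) ^ (2 * θ))⁻¹ := by
            rw [Real.div_rpow (Nat.cast_nonneg _) (by positivity), div_eq_mul_inv,
              Real.rpow_mul hd0.le, Real.rpow_two]
    rw [abs_mul]
    calc |(ArithmeticFunction.moebius d : ℝ)| *
          |∑ k ∈ Ioc 0 (X / d ^ 2), (ArithmeticFunction.liouville k : ℝ)|
        ≤ 1 * (E * ((X / d ^ 2 : ℕ) : ℝ) ^ θ) := mul_le_mul hμ (hL _) (abs_nonneg _) zero_le_one
      _ ≤ E * ((X : ℝ) ^ θ * ((d : ℝ) ^ (2 * θ))⁻¹) := by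
          rw [one_mul]; exact mul_le_mul_of_nonneg_left hq hE
      _ = E * (X : ℝ) ^ θ * ((d : ℝ) ^ (2 * θ))⁻¹ := by ring
  have hid := congrArg (Int.cast : ℤ → ℝ) (quasiRH_sum_moebius_eq X)
  push_cast at hid
  calc |∑ n ∈ Ioc 0 X, (ArithmeticFunction.moebius n : ℝ)|
      = |∑ d ∈ Icc 1 X, (ArithmeticFunction.moebius d : ℝ) *
          ∑ k ∈ Ioc 0 (X / d ^ 2), (ArithmeticFunction.liouville k : ℝ)| := by rw [hid]
    _ ≤ ∑ d ∈ Icc 1 X, |(ArithmeticFunction.moebius d : ℝ) *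
          ∑ k ∈ Ioc 0 (X / d ^ 2), (ArithmeticFunction.liouville k : ℝ)| :=
        Finset.abs_sum_le_sum_abs _ _
    _ ≤ ∑ d ∈ Icc 1 X, E * (X : ℝ) ^ θ * ((d : ℝ) ^ (2 * θ))⁻¹ := Finset.sum_le_sum key
    _ = E * (X : ℝ) ^ θ * ∑ d ∈ Icc 1 X, ((d : ℝ) ^ (2 * θ))⁻¹ := by rw [Finset.mul_sum]
    _ ≤ E * (X : ℝ) ^ θ * S := by
        gcongr
        exact hsum.sum_le_tsum _ (fun d _ => by positivity)
    _ = E * S * (X : ℝ) ^ θ := by ring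

/-- **Big-O over the reals (S5).**  A bound `|M(X)| ≤ F·X^θ` at natural arguments (`θ ≥ 0`,
`F ≥ 0`) gives `M(x) = O(x^θ)` as `x → ∞`, since `M(x) = M(⌊x⌋)` and `⌊x⌋^θ ≤ x^θ` for `x ≥ 0`.
[folklore] -/
theorem quasiRH_mertens_isBigO {θ F : ℝ} (hθ : 0 ≤ θ) (hF : 0 ≤ F)
    (hM : ∀ X : ℕ, |∑ n ∈ Finset.Ioc 0 X, (ArithmeticFunction.moebius n : ℝ)| ≤ F * (X : ℝ) ^ θ) :
    (fun x : ℝ => (Literature.NumberTheory.LFunctions.mertensFunction x : ℝ)) =O[Filter.atTop]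
      fun x : ℝ => x ^ θ := by
  refine Asymptotics.IsBigO.of_bound F ?_
  filter_upwards [Filter.eventually_ge_atTop (0 : ℝ)] with x hx
  rw [Real.norm_eq_abs, Real.norm_eq_abs, abs_of_nonneg (Real.rpow_nonneg hx θ),
    Literature.NumberTheory.LFunctions.mertensFunction]
  push_cast
  calc |∑ n ∈ Ioc 0 ⌊x⌋₊, (ArithmeticFunction.moebius n : ℝ)| ≤ F * (⌊x⌋₊ : ℝ) ^ θ := hM _
    _ ≤ F * x ^ θ :=
        mul_le_mul_of_nonneg_left (Real.rpow_le_rpow (Nat.cast_nonneg _) (Nat.floor_le hx) hθ) hF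

/-- **STUB P5 · `stub_quasiRH_of_progressionMean` (CALIBRATION OF K2).**  The one-point stub K2 of
line `SketchIdeator3` — a power saving `|Σ_{m∈(M,2M]} λ(mn+c)| ≤ C·M^{3/4−κ/2}` along every
progression `c mod n`, `1 ≤ n ≤ 2M` — implies the quasi-Riemann hypothesis at some abscissa
`θ < 3/4`: no zero of `ζ` with `θ < Re s < 1`.  Proof: S1 specialise to `c = 1, n = 1`
(`θ = 3/4 − min κ (1/4) / 2 ∈ [5/8, 3/4)`); S2–S3 binary descent to `L(x) ≪ x^θ`; S4
`M(x) = Σ_d μ(d) L(x/d²) ≪ x^θ`; S5 big-O over the reals; S6 the Mertens dictionary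
`Literature.NumberTheory.LFunctions.quasiRiemannHypothesis_of_mertens_isBigO_holds` (PROVED in
tree; Landau 1899 / Littlewood 1912 / Titchmarsh 1986 §14.25). -/
theorem stub_quasiRH_of_progressionMean :
    (∀ c : ℤ, c ≠ 0 → ∃ κ : ℝ, 0 < κ ∧ ∃ C : ℝ, ∀ M n : ℕ, 1 ≤ n → n ≤ 2 * M →
      |∑ m ∈ Finset.Ioc M (2 * M), (ArithmeticFunction.liouville (Int.toNat ((m : ℤ) * n + c)) : ℝ)|
        ≤ C * (M : ℝ) ^ (3 / 4 - κ / 2)) →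
      ∃ θ : ℝ, θ < 3 / 4 ∧ Literature.NumberTheory.LFunctions.QuasiRiemannHypothesis θ := by
  intro h
  obtain ⟨κ, hκ, C, hC⟩ := h 1 one_ne_zero
  -- S1: the exponent `θ = 3/4 - κ'/2`, `κ' = min κ (1/4)`, lies in `[5/8, 3/4)`
  set κ' : ℝ := min κ (1 / 4) with hκ'
  have hκ'0 : 0 < κ' := lt_min hκ (by norm_num)
  have hκ'κ : κ' ≤ κ := min_le_left _ _
  have hκ'4 : κ' ≤ 1 / 4 := min_le_right _ _
  set θ : ℝ := 3 / 4 - κ' / 2 with hθ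
  have hθ0 : 0 < θ := by linarith
  have hθ1 : θ ≤ 1 := by linarith
  have hC0 : 0 ≤ max C 0 := le_max_right _ _
  -- S1: the instance `c = 1`, `n = 1` of K2: dyadic block bounds for `λ(m+1)`
  have hb : ∀ M : ℕ, 1 ≤ M →
      |∑ m ∈ Finset.Ioc M (2 * M), (ArithmeticFunction.liouville (m + 1) : ℝ)|
        ≤ max C 0 * (M : ℝ) ^ θ := by
    intro M hM
    have h1 := hC M 1 le_rfl (by omega)
    simp only [Nat.cast_one, mul_one, Int.toNat_natCast_add_one] at h1
    have hM1 : (1 : ℝ) ≤ M := by exact_mod_cast hM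
    calc _ ≤ C * (M : ℝ) ^ (3 / 4 - κ / 2) := h1
      _ ≤ max C 0 * (M : ℝ) ^ (3 / 4 - κ / 2) :=
          mul_le_mul_of_nonneg_right (le_max_left _ _) (Real.rpow_nonneg (Nat.cast_nonneg _) _)
      _ ≤ max C 0 * (M : ℝ) ^ θ :=
          mul_le_mul_of_nonneg_left (Real.rpow_le_rpow_of_exponent_le hM1 (by linarith)) hC0
  -- S2–S3: summatory Liouville; S4: Mertens at naturals; S5: big-O; S6: dictionary
  obtain ⟨E, hE0, hE⟩ := quasiRH_liouvilleSum_bound hθ0 hθ1 hC0 hb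
  obtain ⟨F, hF0, hF⟩ := quasiRH_mertens_natCast_bound (by linarith : 1 / 2 < θ) hE0 hE
  have hO := quasiRH_mertens_isBigO hθ0.le hF0 hF
  exact ⟨θ, by linarith,
    Literature.NumberTheory.LFunctions.quasiRiemannHypothesis_of_mertens_isBigO_holds θ hθ0
      (by linarith) hO⟩

end Summit.Parity.GeneralizedHardyLittlewood.Theorems.CosetDecorrelation.FareyLevelMeanCoupling
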